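import Literature.NumberTheory.EllipticCurves.IwasawaNakayamaProofs
import Literature.NumberTheory.EllipticCurves.IwasawaDualModuleTwoVar
import HarnessLib

/-!
# Nakayama's lemma for Pontryagin duals over `Λ₂ = ℤ_p⟦T₂⟧⟦T₁⟧`, I: duality `X⁽¹⁾ ⊆ 𝔪X`, the
# congruence neighbourhoods of `Λ₂^d` and the decomposition `f = pⁿQ + T₁ⁿV + T₂ⁿW` (crux
# `AnticyclotomicEisensteinDivisibility`, stmt-BirchSwinnertonDyer-20727, line `bdpline` v5, stub
# `stub_nakayamaDualTwoVar` — file 1 of 2)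

Helper file (THEOREMS ONLY — no definition, no named fact) for the registered stub
`stub_nakayamaDualTwoVar` of the skeleton `Cruxes/AnticyclotomicEisensteinDivisibility/Lines/bdpline.lean`
(v5, sha16 a2d82a1129796d3f): the TWO-VARIABLE twin of the tree's proved one-variable Nakayama lemma for
Pontryagin duals `Literature.NumberTheory.EllipticCurves.IwasawaDual.IsDualPair.module_finite`
(`IwasawaNakayamaProofs.lean`; Lang, *Cyclotomic Fields I and II*, Ch. 5 §1, "Nakayama's lemma … (ii)
If `𝔬` is compact, and `V/𝔪V` is finitely generated, then `V` is finitely generated"; Greenberg,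
LNM 1716, §1 p. 60), for the nested receptacle `Λ₂ = PowerSeries (PowerSeries ℤ_[p])` of the tree (outer
variable `T₁ = PowerSeries.X` acting as `ψ₁`, inner variable `T₂ = C X` acting as `ψ₂`, constants
`C (C c)` through `ℤ_p → ℤ/p^k`; Rubin 1991 §4: "`Λ = ℤ_p[[𝒢]]` … a power series ring in 2 variables").
The three self-contained ingredients of the sequel `…EisensteinDivisibilityNakayamaDualTwoVar.lean`:

* `exists_eq_nsmul_add_smul_add_smul_of_forall` — the one place where duality is used:
  **`X⁽¹⁾ ⊆ pX + T₁X + T₂X`**: a character `toDual x` killing `S_1 = ker (s ↦ ((p s, ψ₁ s), ψ₂ s))`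
  factors through the image of `δ : S → (S × S) × S` and extends to `(S × S) × S` (injectivity of `ℚ/ℤ`,
  Mathlib `CharacterModule.dual_surjective_of_injective`), i.e. equals
  `y₁ ∘ p + y₂ ∘ ψ₁ + y₃ ∘ ψ₂ = toDual (p x₁ + T₁ x₂ + T₂ x₃)` — the exactness `(X/𝔪X)^∨ = S[𝔪]` of
  Pontryagin duality in the untopologised setting (port of `IsDualPair.mem_mPow_one_of_mem_annPiece`);
* `isOpen_setOf_coeff_cong₂` — the congruence class `{a' | pⁿ ∣ [T₁ʲT₂ˡ](a_i − a'_i), j, l < n}` of a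
  vector `a : ι → Λ₂` is open in the product topology (`PowerSeries.WithPiTopology` twice,
  `PadicInt` ultrametric balls) (port of `IwasawaDual.isOpen_setOf_cong`);
* `exists_eq_C_mul_add_X_pow_mul_add` — a two-variable power series whose coefficients `[T₁ʲT₂ˡ]`,
  `j, l < n`, are divisible by `pⁿ` is `C(C pⁿ)·Q + T₁ⁿ·V + T₂ⁿ·W` (coefficientwise, `PowerSeries.ext`,
  `coeff_X_pow_mul'`).

Nothing here bears on the other stubs of the line or on BSD.

## References
* S. Lang, *Cyclotomic Fields I and II*, GTM 121 (1990), Ch. 5 §1 (Nakayama's lemma).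
* R. Greenberg, *Iwasawa theory for elliptic curves*, LNM 1716 (1999), §1 p. 60.
* K. Rubin, Invent. Math. 103 (1991), §4 p. 36.
-/

-- D-0017: single-problem summit, the namespace repeats the problem name by design.
set_option linter.dupNamespace false
set_option autoImplicit false

open Literature.NumberTheory.EllipticCurves

noncomputable section

namespace Summit.BirchSwinnertonDyer.BirchSwinnertonDyer.Theorems.SignedBaseChangeAcDivNakayamaTwoVar

/-! ## §1. Duality: `X⁽¹⁾ ⊆ pX + T₁X + T₂X` -/

section Duality

variable {p : ℕ} [Fact p.Prime]
variable {S : Type*} [AddCommGroup S] {ψ₁ ψ₂ : AddMonoid.End S}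
variable {X : Type*} [AddCommGroup X] [Module (PowerSeries (PowerSeries ℤ_[p])) X]
variable {toDual : X →+ (S →+ AddCircle (1 : ℚ))}

/-- **`X⁽¹⁾ ⊆ pX + T₁X + T₂X`** — the dual of `S[𝔪] = ker (s ↦ ((p s, ψ₁ s), ψ₂ s))` for a Pontryagin-dual
pair over `Λ₂` (`toDual : X ≃ Hom(S, ℚ/ℤ)`, `T₁ ↦ ψ₁`, `T₂ = C X ↦ ψ₂`): a character `toDual x` killing
`S_1 = {s | p s = 0, ψ₁ s = 0, ψ₂ s = 0}` factors through the image of `δ : S → (S × S) × S`, extends to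
`(S × S) × S` (injectivity of `ℚ/ℤ`, Mathlib `CharacterModule.dual_surjective_of_injective`) as
`((y₁, y₂), y₃)`, so `toDual x = y₁ ∘ p + y₂ ∘ ψ₁ + y₃ ∘ ψ₂ = toDual (p x₁ + T₁ x₂ + T₂ x₃)`. The exactness
`(X/𝔪X)^∨ = S[𝔪]` of Pontryagin duality, two variables (Greenberg 1999 p. 60, "`X/𝔪X` is finite" ⟺
`S[𝔪]` finite). [cite: GreenbergLNM1716, §1 p. 60 (after Conj. 1.3)] -/
theorem exists_eq_nsmul_add_smul_add_smul_of_forall (hbij : Function.Bijective toDual)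
    (hT₁ : ∀ (x : X) (s : S),
      toDual ((PowerSeries.X : PowerSeries (PowerSeries ℤ_[p])) • x) s = toDual x (ψ₁ s))
    (hT₂ : ∀ (x : X) (s : S),
      toDual ((PowerSeries.C (PowerSeries.X : PowerSeries ℤ_[p]) : PowerSeries (PowerSeries ℤ_[p])) • x) s =
        toDual x (ψ₂ s))
    {x : X} (hx : ∀ s : S, p • s = 0 → ψ₁ s = 0 → ψ₂ s = 0 → toDual x s = 0) :
    ∃ x₁ x₂ x₃ : X, x = p • x₁ + (PowerSeries.X : PowerSeries (PowerSeries ℤ_[p])) • x₂ +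
      (PowerSeries.C (PowerSeries.X : PowerSeries ℤ_[p]) : PowerSeries (PowerSeries ℤ_[p])) • x₃ := by
  -- `δ : S → (S × S) × S`, `s ↦ ((p s, ψ₁ s), ψ₂ s)`, with kernel `S_1`
  let δ : S →+ (S × S) × S := ((DistribSMul.toAddMonoidHom S (p : ℕ)).prod ψ₁).prod ψ₂
  have hδ : ∀ s, δ s = ((p • s, ψ₁ s), ψ₂ s) := fun s ↦ rfl
  have hker : δ.rangeRestrict.ker ≤ (toDual x).ker := by
    intro s hs
    rw [AddMonoidHom.mem_ker] at hs ⊢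
    have hs' : δ s = 0 := congrArg (fun z : δ.range ↦ (z : (S × S) × S)) hs
    rw [hδ, Prod.mk_eq_zero, Prod.mk_eq_zero] at hs'
    exact hx s hs'.1.1 hs'.1.2 hs'.2
  have hsurj : Function.Surjective δ.rangeRestrict := AddMonoidHom.rangeRestrict_surjective δ
  let χ' : δ.range →+ AddCircle (1 : ℚ) := δ.rangeRestrict.liftOfSurjective hsurj ⟨toDual x, hker⟩
  have hχ' : ∀ s, χ' (δ.rangeRestrict s) = toDual x s := fun s ↦
    AddMonoidHom.liftOfRightInverse_comp_apply _ _ _ _ s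
  obtain ⟨y, hy⟩ := CharacterModule.dual_surjective_of_injective
    (δ.range.subtype.toIntLinearMap) (fun a b hab ↦ Subtype.ext hab) χ'
  have hy' : ∀ g : δ.range, y g = χ' g := fun g ↦ by
    have := DFunLike.congr_fun hy g
    rw [CharacterModule.dual_apply] at this
    exact this
  let y₀ : (S × S) × S →+ AddCircle (1 : ℚ) := y
  let y₁ : S →+ AddCircle (1 : ℚ) := y₀.comp ((AddMonoidHom.inl (S × S) S).comp (AddMonoidHom.inl S S))
  let y₂ : S →+ AddCircle (1 : ℚ) := y₀.comp ((AddMonoidHom.inl (S × S) S).comp (AddMonoidHom.inr S S))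
  let y₃ : S →+ AddCircle (1 : ℚ) := y₀.comp (AddMonoidHom.inr (S × S) S)
  have hsplit : ∀ s, toDual x s = y₁ (p • s) + y₂ (ψ₁ s) + y₃ (ψ₂ s) := by
    intro s
    have e1 : toDual x s = y₀ ((δ.rangeRestrict s : δ.range) : (S × S) × S) := by
      rw [← hχ' s, ← hy']
      rfl
    rw [e1]
    change y₀ (δ s) = y₀ ((p • s, 0), 0) + y₀ ((0, ψ₁ s), 0) + y₀ ((0, 0), ψ₂ s)
    rw [← map_add, ← map_add, Prod.mk_add_mk, Prod.mk_add_mk, Prod.mk_add_mk, Prod.mk_add_mk,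
      add_zero, zero_add, add_zero, zero_add, add_zero, zero_add, hδ]
  obtain ⟨x₁, hx₁⟩ := hbij.2 y₁
  obtain ⟨x₂, hx₂⟩ := hbij.2 y₂
  obtain ⟨x₃, hx₃⟩ := hbij.2 y₃
  refine ⟨x₁, x₂, x₃, hbij.1 ?_⟩
  ext s
  rw [map_add, map_add, AddMonoidHom.add_apply, AddMonoidHom.add_apply, IwasawaDual.nsmul_eval,
    hT₁, hT₂, hx₁, hx₂, hx₃, hsplit]

end Duality

/-! ## §2. Congruence neighbourhoods in `Λ₂^ι` and the decomposition `f = pⁿ Q + T₁ⁿ V + T₂ⁿ W` -/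

section Compact

open scoped PowerSeries.WithPiTopology

variable {p : ℕ} [Fact p.Prime] {ι : Type*}

/-- The congruence class `{a' | pⁿ ∣ [T₂ˡ][T₁ʲ](a_i) − [T₂ˡ][T₁ʲ](a'_i) for all i and j, l < n}` of a
vector `a : ι → Λ₂` (`ι` finite) is open in the product topology of `Λ₂^ι`
(`PowerSeries.WithPiTopology` on both levels): a finite intersection of preimages, under the continuous
double coefficient maps, of closed balls of radius `p⁻ⁿ` in `ℤ_p`, which are open (ultrametric). Port of
`IwasawaDual.isOpen_setOf_cong`. [folklore] -/
theorem isOpen_setOf_coeff_cong₂ [Finite ι] (n : ℕ) (a : ι → PowerSeries (PowerSeries ℤ_[p])) :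
    IsOpen {a' : ι → PowerSeries (PowerSeries ℤ_[p]) | ∀ i, ∀ j < n, ∀ l < n,
      (p : ℤ_[p]) ^ n ∣ PowerSeries.coeff l (PowerSeries.coeff j (a i)) -
        PowerSeries.coeff l (PowerSeries.coeff j (a' i))} := by
  have hp := (Fact.out : p.Prime)
  have e : {a' : ι → PowerSeries (PowerSeries ℤ_[p]) | ∀ i, ∀ j < n, ∀ l < n,
      (p : ℤ_[p]) ^ n ∣ PowerSeries.coeff l (PowerSeries.coeff j (a i)) -
        PowerSeries.coeff l (PowerSeries.coeff j (a' i))} =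
      ⋂ i : ι, ⋂ j ∈ Finset.range n, ⋂ l ∈ Finset.range n,
        (fun a' : ι → PowerSeries (PowerSeries ℤ_[p]) ↦ PowerSeries.coeff l (PowerSeries.coeff j (a' i))) ⁻¹'
          {c : ℤ_[p] | (p : ℤ_[p]) ^ n ∣ PowerSeries.coeff l (PowerSeries.coeff j (a i)) - c} := by
    ext a'
    simp only [Set.mem_setOf_eq, Set.mem_iInter, Finset.mem_range, Set.mem_preimage]
  rw [e]
  refine isOpen_iInter_of_finite fun i ↦ isOpen_biInter_finset fun j _ ↦
    isOpen_biInter_finset fun l _ ↦ ?_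
  refine IsOpen.preimage ((PowerSeries.WithPiTopology.continuous_coeff ℤ_[p] l).comp
    ((PowerSeries.WithPiTopology.continuous_coeff (PowerSeries ℤ_[p]) j).comp (continuous_apply i))) ?_
  have e2 : {c : ℤ_[p] | (p : ℤ_[p]) ^ n ∣ PowerSeries.coeff l (PowerSeries.coeff j (a i)) - c} =
      Metric.closedBall (PowerSeries.coeff l (PowerSeries.coeff j (a i))) ((p : ℝ) ^ (-(n : ℤ))) := by
    ext c
    rw [Set.mem_setOf_eq, Metric.mem_closedBall, dist_comm, dist_eq_norm,
      PadicInt.norm_le_pow_iff_mem_span_pow, Ideal.mem_span_singleton]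
  rw [e2]
  exact IsUltrametricDist.isOpen_closedBall _ (zpow_ne_zero _ (by exact_mod_cast hp.ne_zero))

/-- **Coefficient decomposition in `Λ₂`.** A two-variable power series `f` whose coefficients
`[T₂ˡ][T₁ʲ] f` with `j, l < n` are all divisible by `pⁿ` is of the form
`f = C(C pⁿ)·Q + T₁ⁿ·V + T₂ⁿ·W` (`T₁ = X`, `T₂ = C X`): split off the `T₁`-tail `V` (coefficients of
degree `≥ n` in `T₁`), then in each remaining `T₁`-coefficient split off the `T₂`-tail and divide the
low coefficients by `pⁿ`; checked coefficientwise (`PowerSeries.ext`, `coeff_X_pow_mul'`, `coeff_C_mul`).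
Port of the decomposition inside `IsDualPair.smul_mem_annPiece`. [folklore] -/
theorem exists_eq_C_mul_add_X_pow_mul_add {n : ℕ} {f : PowerSeries (PowerSeries ℤ_[p])}
    (hf : ∀ j < n, ∀ l < n, (p : ℤ_[p]) ^ n ∣ PowerSeries.coeff l (PowerSeries.coeff j f)) :
    ∃ Q V W : PowerSeries (PowerSeries ℤ_[p]),
      f = PowerSeries.C (PowerSeries.C ((p : ℤ_[p]) ^ n)) * Q + PowerSeries.X ^ n * V +
        (PowerSeries.C (PowerSeries.X : PowerSeries ℤ_[p])) ^ n * W := by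
  classical
  -- choose the quotients `q j l` with `coeff l (coeff j f) = p^n * q j l` for `j, l < n`
  have hq : ∀ j l : ℕ, ∃ q : ℤ_[p], j < n → l < n →
      PowerSeries.coeff l (PowerSeries.coeff j f) = (p : ℤ_[p]) ^ n * q := by
    intro j l
    by_cases hj : j < n
    · by_cases hl : l < n
      · obtain ⟨q, hq⟩ := hf j hj l hl
        exact ⟨q, fun _ _ ↦ hq⟩
      · exact ⟨0, fun _ h ↦ absurd h hl⟩
    · exact ⟨0, fun h _ ↦ absurd h hj⟩
  choose q hq using hq
  -- the three pieces
  let Q : PowerSeries (PowerSeries ℤ_[p]) :=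
    PowerSeries.mk fun j ↦ PowerSeries.mk fun l ↦ if j < n ∧ l < n then q j l else 0
  let V : PowerSeries (PowerSeries ℤ_[p]) := PowerSeries.mk fun j ↦ PowerSeries.coeff (j + n) f
  let W : PowerSeries (PowerSeries ℤ_[p]) :=
    PowerSeries.mk fun j ↦ if j < n then PowerSeries.mk fun l ↦ PowerSeries.coeff (l + n) (PowerSeries.coeff j f)
      else 0
  refine ⟨Q, V, W, ?_⟩
  have hCX : (PowerSeries.C (PowerSeries.X : PowerSeries ℤ_[p])) ^ n =
      PowerSeries.C ((PowerSeries.X : PowerSeries ℤ_[p]) ^ n) := (map_pow _ _ _).symm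
  refine PowerSeries.ext fun j ↦ ?_
  rw [map_add, map_add, PowerSeries.coeff_C_mul, PowerSeries.coeff_X_pow_mul', hCX,
    PowerSeries.coeff_C_mul]
  have hQ : PowerSeries.coeff j Q = PowerSeries.mk fun l ↦ if j < n ∧ l < n then q j l else 0 :=
    PowerSeries.coeff_mk _ _
  have hW : PowerSeries.coeff j W =
      if j < n then PowerSeries.mk fun l ↦ PowerSeries.coeff (l + n) (PowerSeries.coeff j f) else 0 :=
    PowerSeries.coeff_mk _ _
  rw [hQ, hW]
  by_cases hj : j < n
  · -- low `T₁`-degree: `coeff j f = C(p^n) * Q_j + X^n * W_j` in `Λ₁`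
    rw [if_neg (not_le.mpr hj), add_zero, if_pos hj]
    refine PowerSeries.ext fun l ↦ ?_
    rw [map_add, PowerSeries.coeff_C_mul, PowerSeries.coeff_X_pow_mul', PowerSeries.coeff_mk]
    by_cases hl : l < n
    · rw [if_pos ⟨hj, hl⟩, if_neg (not_le.mpr hl), add_zero]
      exact hq j l hj hl
    · have hnl : n ≤ l := not_lt.mp hl
      rw [if_neg (fun h ↦ hl h.2), if_pos hnl, mul_zero, zero_add, PowerSeries.coeff_mk,
        Nat.sub_add_cancel hnl]
  · -- high `T₁`-degree: `coeff j f = coeff (j - n) V`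
    have hnj : n ≤ j := not_lt.mp hj
    have hV : PowerSeries.coeff (j - n) V = PowerSeries.coeff j f := by
      change PowerSeries.coeff (j - n) (PowerSeries.mk fun j ↦ PowerSeries.coeff (j + n) f) = _
      rw [PowerSeries.coeff_mk, Nat.sub_add_cancel hnj]
    rw [if_pos hnj, if_neg hj, hV, mul_zero, add_zero]
    refine PowerSeries.ext fun l ↦ ?_
    rw [map_add, PowerSeries.coeff_C_mul, PowerSeries.coeff_mk, if_neg (fun h ↦ hj h.1), mul_zero,
      zero_add]

end Compact

end Summit.BirchSwinnertonDyer.BirchSwinnertonDyer.Theorems.SignedBaseChangeAcDivNakayamaTwoVar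

end
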